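import Summits.CriticalPhenomena.PercolationContinuityZ3.Theorems.SahiTP2Kernel

/-!
# TP₂ across a cut on a general conditioning space: an a.e. stochastically increasing version of the
# conditional law (the kernel behind the monotone coupling of box-TP₂ laws on `Q_d`, every `d`)

Support file of the Sahi cell (`prim-sahi`, typer seat, generation 11; `--supports stmt-CriticalPhenomena-4575`).
Mathlib plus `SahiTP2Kernel.lean` (generation 10) for one `ℝ≥0∞` rearrangement.

Generation 10 treated laws on `ℝ × ℝ`: TP₂ across cuts ⟹ Mathlib's conditional-cdf kernel is stochastically
increasing on a set of full measure (`SahiTP2.exists_aeCisKernel`, Besicovitch differentiation on `ℝ`).  Here the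
conditioning variable lives in an arbitrary metric measurable preorder `α` with the Besicovitch covering property
(the target: the cube `[0,1]^d` with the sup metric and the coordinatewise order), and the hypothesis is phrased on
CONCENTRIC-RADIUS closed balls: `IsBallTP2Cut ρ` asks
`ρ(B̄(a,h) × (t,∞)) ρ(B̄(b,h) × (-∞,t]) ≤ ρ(B̄(a,h) × (-∞,t]) ρ(B̄(b,h) × (t,∞))` for `a ≤ b`, `h > 0`, `t ∈ ℝ`.
On the cube two sup-balls of equal radius around `a ≤ b` are closed boxes in the strong (coordinatewise) set
order, so the condition follows from total positivity of order two on closed boxes (`SahiBoxTP2Coupling.lean`);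
for `d ≥ 2` it is NOT implied by conditional increasingness alone (comparable centres, incomparable mass).

* `ball_ratio_le` — the ball ratios `ρ(B̄(a,h) × (-∞,q]) / ρ.fst(B̄(a,h))` decrease in the centre (same radius);
* `goodSet₀`, `ae_mem_goodSet₀` — Besicovitch differentiation (`Besicovitch.ae_tendsto_rnDeriv` on `α`): the ratios
  converge `ρ.fst`-a.e. to Mathlib's `preCDF ρ q`, simultaneously for all rationals, at Stieltjes points;
* `preCDF_anti_of_mem_goodSet₀`, `condCDF_anti_of_mem_goodSet₀` — so `preCDF`/`condCDF` are ANTITONE in the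
  conditioning variable on the (full-measure) good set;
* **`exists_aeCisKernel`** — every finite `IsBallTP2Cut` measure `ρ` on `α × ℝ` is `ρ.fst ⊗ₘ κ` for a Markov kernel
  `κ : α → ℝ` (the conditional-cdf kernel) with `a ≤ b ⇒ κ_b((-∞,t]) ≤ κ_a((-∞,t])` for `a, b` in a set of full
  `ρ.fst`-measure.  (For `d ≥ 2` an everywhere-monotone BOREL version need not exist — a monotone envelope over the
  good set is antitone but in general only analytic-measurable — and none is needed downstream: the standard
  construction then gives a Borel map that is monotone almost everywhere, which is all Sahi positivity uses.)

`MTP₂ ⇒ conditionally increasing` for densities is [folklore] (Karlin–Rinott 1980; Belzunce–Martínez-Riquelme–Mulero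
2016, §1.3.4); the ball form for singular laws and its Besicovitch proof are this work.  No sorries, no new axioms.
-/

noncomputable section

namespace Summit.CriticalPhenomena.PercolationContinuityZ3.Theorems.SahiBoxTP2

open MeasureTheory ProbabilityTheory Set Filter Topology Metric Function
open scoped ENNReal

/-- **TP₂ across a cut, ball form**: for centres `a ≤ b`, a common radius `h > 0` and a threshold `t`,
`ρ(B̄(a,h) × (t,∞)) · ρ(B̄(b,h) × (-∞,t]) ≤ ρ(B̄(a,h) × (-∞,t]) · ρ(B̄(b,h) × (t,∞))` — the conditional laws of the
centre variable given `{Y ≤ t}` and `{Y > t}` are likelihood-ratio ordered on concentric-radius balls.  On the cube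
`[0,1]^d` (sup metric, coordinatewise order) it follows from TP₂ on closed boxes. [this work] -/
def IsBallTP2Cut {α : Type*} [PseudoMetricSpace α] [Preorder α] [MeasurableSpace α] (ρ : Measure (α × ℝ)) : Prop :=
  ∀ ⦃a b : α⦄, a ≤ b → ∀ ⦃h : ℝ⦄, 0 < h → ∀ t : ℝ,
    ρ (closedBall a h ×ˢ Ioi t) * ρ (closedBall b h ×ˢ Iic t) ≤
      ρ (closedBall a h ×ˢ Iic t) * ρ (closedBall b h ×ˢ Ioi t)

variable {α : Type*} [MetricSpace α] [MeasurableSpace α] [BorelSpace α]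

section Ratio

variable (ρ : Measure (α × ℝ))

omit [MetricSpace α] [BorelSpace α] in
/-- The first marginal splits along a measurable set of the second coordinate and its complement:
`ρ.fst(s) = ρ(s × L) + ρ(s × Lᶜ)`. [folklore] -/
theorem fst_eq_add_prod_compl {s : Set α} (hs : MeasurableSet s) {L : Set ℝ} (hL : MeasurableSet L) :
    ρ.fst s = ρ (s ×ˢ L) + ρ (s ×ˢ Lᶜ) := by
  rw [Measure.fst_apply hs, ← Set.prod_univ, ← Set.union_compl_self L, Set.prod_union]
  exact measure_union (Set.disjoint_prod.2 (Or.inr disjoint_compl_right)) (hs.prod hL.compl)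

/-- **Ball ratios decrease in the centre** under `IsBallTP2Cut`: for `a ≤ b`, a common radius `h > 0` and every
`q`, `ρ(B̄(b,h) × (-∞,q]) / ρ.fst(B̄(b,h)) ≤ ρ(B̄(a,h) × (-∞,q]) / ρ.fst(B̄(a,h))` as soon as `ρ.fst(B̄(a,h)) > 0`.
[this work] -/
theorem ball_ratio_le [Preorder α] [IsFiniteMeasure ρ] (hρ : IsBallTP2Cut ρ) {a b : α} (hab : a ≤ b) {h : ℝ}
    (hh : 0 < h) (q : ℝ) (hpos : 0 < ρ.fst (closedBall a h)) :
    ρ.IicSnd q (closedBall b h) / ρ.fst (closedBall b h) ≤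
      ρ.IicSnd q (closedBall a h) / ρ.fst (closedBall a h) := by
  rw [Measure.IicSnd_apply _ _ measurableSet_closedBall, Measure.IicSnd_apply _ _ measurableSet_closedBall,
    fst_eq_add_prod_compl ρ measurableSet_closedBall (measurableSet_Iic (a := q)),
    fst_eq_add_prod_compl ρ measurableSet_closedBall (measurableSet_Iic (a := q))]
  rw [fst_eq_add_prod_compl ρ measurableSet_closedBall (measurableSet_Iic (a := q))] at hpos
  have key : ρ (closedBall a h ×ˢ (Iic q)ᶜ) * ρ (closedBall b h ×ˢ Iic q) ≤
      ρ (closedBall a h ×ˢ Iic q) * ρ (closedBall b h ×ˢ (Iic q)ᶜ) := by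
    rw [Set.compl_Iic]
    exact hρ hab hh q
  exact SahiTP2.div_add_le_div_add key hpos.ne' (ENNReal.add_ne_top.2 ⟨measure_ne_top _ _, measure_ne_top _ _⟩)
    (ENNReal.add_ne_top.2 ⟨measure_ne_top _ _, measure_ne_top _ _⟩)

omit [BorelSpace α] in
/-- Almost every point of a second-countable metric space has all its balls of positive mass. [folklore] -/
theorem ae_fst_closedBall_pos [SecondCountableTopology α] :
    ∀ᵐ a ∂ρ.fst, ∀ h : ℝ, 0 < h → 0 < ρ.fst (closedBall a h) := by
  have hnull : ρ.fst {a | ∃ h : ℝ, 0 < h ∧ ρ.fst (closedBall a h) = 0} = 0 := by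
    refine measure_null_of_locally_null _ fun a ha => ?_
    obtain ⟨h, hh, h0⟩ := ha
    exact ⟨closedBall a h, mem_nhdsWithin_of_mem_nhds (closedBall_mem_nhds a hh), h0⟩
  rw [ae_iff]
  refine measure_mono_null (fun a ha => ?_) hnull
  simp only [mem_setOf_eq, not_forall, not_lt, nonpos_iff_eq_zero, exists_prop] at ha ⊢
  exact ha

/-- **The good set**: Besicovitch limits of the ball ratios to `preCDF ρ q a` for every rational `q`, a Stieltjes
point of `preCDF`, `preCDF ≤ 1`, and balls of positive mass. [this work] -/
def goodSet₀ : Set α :=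
  {a | (∀ q : ℚ, Tendsto (fun h : ℝ => ρ.IicSnd q (closedBall a h) / ρ.fst (closedBall a h)) (𝓝[>] 0)
      (𝓝 (preCDF ρ q a))) ∧
    IsRatStieltjesPoint (fun a q => (preCDF ρ q a).toReal) a ∧ (∀ q : ℚ, preCDF ρ q a ≤ 1) ∧
    (∀ h : ℝ, 0 < h → 0 < ρ.fst (closedBall a h))}

variable {ρ}

/-- **The good set has full `ρ.fst`-measure** (Besicovitch differentiation on `α`, countably many rationals).
[this work] -/
theorem ae_mem_goodSet₀ [SecondCountableTopology α] [HasBesicovitchCovering α] [IsFiniteMeasure ρ] :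
    ∀ᵐ a ∂ρ.fst, a ∈ goodSet₀ ρ := by
  have h1 : ∀ᵐ a ∂ρ.fst, ∀ q : ℚ, Tendsto (fun h : ℝ => ρ.IicSnd q (closedBall a h) / ρ.fst (closedBall a h))
      (𝓝[>] 0) (𝓝 (preCDF ρ q a)) := by
    rw [ae_all_iff]
    intro q
    haveI : IsFiniteMeasure (ρ.IicSnd q) := Measure.IsFiniteMeasure.IicSnd (ρ := ρ) q
    exact Besicovitch.ae_tendsto_rnDeriv (ρ.IicSnd q) ρ.fst
  have h2 : ∀ᵐ a ∂ρ.fst, IsRatStieltjesPoint (fun a q => (preCDF ρ q a).toReal) a := by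
    have h := (isRatCondKernelCDF_preCDF ρ).isRatStieltjesPoint_ae ()
    simp only [Kernel.const_apply] at h
    filter_upwards [h] with a ha using (isRatStieltjesPoint_unit_prod_iff _ a).1 ha
  filter_upwards [h1, h2, preCDF_le_one ρ, ae_fst_closedBall_pos ρ] with a ha1 ha2 ha3 ha4
  exact ⟨ha1, ha2, ha3, ha4⟩

/-- **`preCDF` is antitone on the good set** of an `IsBallTP2Cut` law: the a.e. limit of ball ratios that
decrease in the centre at every fixed radius. [this work] -/
theorem preCDF_anti_of_mem_goodSet₀ [Preorder α] [IsFiniteMeasure ρ] (hρ : IsBallTP2Cut ρ) {a b : α}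
    (ha : a ∈ goodSet₀ ρ) (hb : b ∈ goodSet₀ ρ) (hab : a ≤ b) (q : ℚ) : preCDF ρ q b ≤ preCDF ρ q a := by
  refine le_of_tendsto_of_tendsto (hb.1 q) (ha.1 q) ?_
  filter_upwards [self_mem_nhdsWithin] with h hh
  exact ball_ratio_le ρ hρ hab hh q (ha.2.2.2 h hh)

/-- **Mathlib's conditional cdf is antitone in the conditioning variable on the good set** of an `IsBallTP2Cut`
law (pass to the infimum over rationals above a real threshold). [this work] -/
theorem condCDF_anti_of_mem_goodSet₀ [Preorder α] [IsFiniteMeasure ρ] (hρ : IsBallTP2Cut ρ) {a b : α}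
    (ha : a ∈ goodSet₀ ρ) (hb : b ∈ goodSet₀ ρ) (hab : a ≤ b) (x : ℝ) : condCDF ρ b x ≤ condCDF ρ a x := by
  have hval : ∀ c ∈ goodSet₀ ρ, ∀ r : ℚ, condCDF ρ c r = (preCDF ρ r c).toReal := fun c hc r => by
    rw [condCDF, stieltjesOfMeasurableRat_eq, toRatCDF_of_isRatStieltjesPoint hc.2.1]
  rw [← StieltjesFunction.iInf_rat_gt_eq (condCDF ρ b) x, ← StieltjesFunction.iInf_rat_gt_eq (condCDF ρ a) x]
  have hbdd : BddBelow (range fun r : {r' : ℚ // x < r'} => condCDF ρ b r) :=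
    ⟨0, by rintro y ⟨r, rfl⟩; exact condCDF_nonneg ρ b _⟩
  refine ciInf_mono hbdd fun r => ?_
  rw [hval b hb, hval a ha]
  exact ENNReal.toReal_mono ((ha.2.2.1 r).trans_lt ENNReal.one_lt_top).ne
    (preCDF_anti_of_mem_goodSet₀ hρ ha hb hab r)

end Ratio

/-- **Main construction (a.e.-monotone conditional law).** On a second-countable Borel metric preorder with the
Besicovitch covering property, every finite `IsBallTP2Cut` measure `ρ` on `α × ℝ` is the composition-product of its
first marginal with a Markov kernel `κ : α → ℝ` (the conditional-cdf kernel) that is stochastically increasing —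
`a ≤ b ⇒ κ_b((-∞,t]) ≤ κ_a((-∞,t])` for every real `t` — for `a, b` in a set of full `ρ.fst`-measure. [this work] -/
theorem exists_aeCisKernel [SecondCountableTopology α] [HasBesicovitchCovering α] [Preorder α]
    {ρ : Measure (α × ℝ)} [IsFiniteMeasure ρ] (hρ : IsBallTP2Cut ρ) :
    ∃ κ : Kernel α ℝ, IsMarkovKernel κ ∧ ρ.fst ⊗ₘ κ = ρ ∧ ∃ G : Set α, (∀ᵐ a ∂ρ.fst, a ∈ G) ∧
      ∀ ⦃a b : α⦄, a ∈ G → b ∈ G → a ≤ b → ∀ t : ℝ, κ b (Iic t) ≤ κ a (Iic t) := by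
  have hK := isCondKernelCDF_condCDF ρ
  set K := hK.toKernel _ with hKdef
  refine ⟨Kernel.comap K (fun a => ((), a)) measurable_prodMk_left, inferInstance, ?_, goodSet₀ ρ, ae_mem_goodSet₀,
    fun a b ha hb hab t => ?_⟩
  · have h2 : Kernel.prodMkLeft Unit (Kernel.comap K (fun a => ((), a)) measurable_prodMk_left) = K := by
      ext p s hs
      rcases p with ⟨u, a⟩
      rfl
    have h3 : Kernel.const Unit ρ.fst ⊗ₖ K = Kernel.const Unit ρ := compProd_toKernel hK
    rw [Measure.compProd, h2, h3, Kernel.const_apply]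
  · rw [Kernel.comap_apply, Kernel.comap_apply, hKdef, IsCondKernelCDF.toKernel_Iic, IsCondKernelCDF.toKernel_Iic]
    exact ENNReal.ofReal_le_ofReal (condCDF_anti_of_mem_goodSet₀ hρ ha hb hab t)

end Summit.CriticalPhenomena.PercolationContinuityZ3.Theorems.SahiBoxTP2
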